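import Summits.CriticalPhenomena.CardyFormulaZ2.Theorems.CardyFlipRussoVoronoiHubFromSmirnovDefs

/-!
# Stub `image_crossing_iff_preimage` of line `moebius-exact-delaunay-dilation-ward`
# (crux `VoronoiHubFromSmirnov`, stmt-CriticalPhenomena-6433)

**Continuum crossings of an image rectangle pull back under an embedding of the closure.**
Let `R = (Ω; a, b, c, d)` be a conformal rectangle and `h : ℂ → ℂ` continuous and injective on
the compact set `closure Ω`.  The image rectangle `h • R` has arcs `h '' R.arc i` and closed
carrier `closure (h '' Ω) = h '' closure Ω` (`closure_image_of_isBounded`).  For every set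
`A ⊆ ℂ` (the black region of a colouring, say) the two crossing events agree:

* there is a continuum path inside `closure (h '' Ω) ∩ A` from a point of `h '' R.arc 0` to a
  point of `h '' R.arc 2`, iff
* there is a continuum path inside `closure Ω ∩ h ⁻¹' A` from a point of `R.arc 0` to a point of
  `R.arc 2`.

Proof.  (←) push the path forward by `h`, continuous on `closure Ω ⊇ closure Ω ∩ h ⁻¹' A`
(`JoinedIn.map_continuousOn`); its image lies in `h '' closure Ω ∩ A = closure (h '' Ω) ∩ A`.
(→) `closure (h '' Ω) ∩ A ⊆ h '' closure Ω`, on which the inverse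
`g = Function.invFunOn h (closure Ω)` is continuous (`continuousOn_invFunOn_of_isCompact`:
a continuous bijection of a compact set onto a Hausdorff space is a homeomorphism); push the path
forward by `g`: its image lies in `closure Ω ∩ h ⁻¹' A` (`h (g w) = w ∈ A`), and its endpoints
are `g (h x₀) = x₀ ∈ R.arc 0`, `g (h y₀) = y₀ ∈ R.arc 2` because the arcs lie in
`frontier Ω ⊆ closure Ω` (`MarkedDomain.arc_subset_frontier`).

No new definitions; Mathlib (`JoinedIn.map_continuousOn`, `JoinedIn.mono`,
`Set.InjOn.leftInvOn_invFunOn`, `Function.invFunOn_eq`) and the tree lemmas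
`closure_image_of_isBounded`, `continuousOn_invFunOn_of_isCompact`
(`Literature.Probability.RandomPlanarGeometry`).
-/

noncomputable section

namespace Summit.CriticalPhenomena.CardyFormulaZ2.Cruxes.VoronoiHubFromSmirnov.MoebiusExactDelaunayDilationWard

open Set Filter Topology
open Literature.Probability.RandomPlanarGeometry

/-- **Boundary arcs lie in the closed carrier**: `R.arc i ⊆ closure Ω`
(arcs are subsets of the frontier, `MarkedDomain.arc_subset_frontier`). -/
theorem icp_arc_subset_closure {n : ℕ} (D : MarkedDomain n) (i : Fin n) :
    D.arc i ⊆ closure D.carrier :=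
  (D.arc_subset_frontier i).trans frontier_subset_closure

/-- **Pushing a path forward into a prescribed set.** If `x, y` are joined inside `F`, `f` is
continuous on some `G ⊇ F` and `f '' F ⊆ T`, then `f x, f y` are joined inside `T`. -/
theorem icp_joinedIn_map_of_subset {F G T : Set ℂ} {f : ℂ → ℂ} {x y : ℂ}
    (hJ : JoinedIn F x y) (hf : ContinuousOn f G) (hFG : F ⊆ G) (hT : f '' F ⊆ T) :
    JoinedIn T (f x) (f y) :=
  (hJ.map_continuousOn (hf.mono hFG)).mono hT

/-- **The forward direction `h • R ⟶ R`.** For `h` continuous and injective on `closure Ω`, a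
path inside `closure (h '' Ω) ∩ A` joining `h x₀` to `h y₀` (`x₀, y₀ ∈ closure Ω`) pulls back,
along the continuous inverse `Function.invFunOn h (closure Ω)`, to a path inside
`closure Ω ∩ h ⁻¹' A` joining `x₀` to `y₀`. -/
theorem icp_joinedIn_preimage_of_image (R : ConformalRectangle) {h : ℂ → ℂ}
    (hc : ContinuousOn h (closure R.carrier)) (hi : InjOn h (closure R.carrier)) (A : Set ℂ)
    {x₀ y₀ : ℂ} (hx₀ : x₀ ∈ closure R.carrier) (hy₀ : y₀ ∈ closure R.carrier)
    (hJ : JoinedIn (closure (h '' R.carrier) ∩ A) (h x₀) (h y₀)) :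
    JoinedIn (closure R.carrier ∩ h ⁻¹' A) x₀ y₀ := by
  have hcl : closure (h '' R.carrier) = h '' closure R.carrier :=
    closure_image_of_isBounded R.isBounded hc
  -- the inverse of `h` on the compact `closure Ω`, continuous on `h '' closure Ω`
  have hginv : ∀ z ∈ closure R.carrier, Function.invFunOn h (closure R.carrier) (h z) = z :=
    fun z hz => hi.leftInvOn_invFunOn hz
  have hgc : ContinuousOn (Function.invFunOn h (closure R.carrier)) (h '' closure R.carrier) :=
    continuousOn_invFunOn_of_isCompact R.isBounded.isCompact_closure hc hi.bijOn_image
  have hsub : closure (h '' R.carrier) ∩ A ⊆ h '' closure R.carrier := by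
    rw [hcl]
    exact inter_subset_left
  have hJ' := icp_joinedIn_map_of_subset (T := closure R.carrier ∩ h ⁻¹' A) hJ hgc hsub (by
    rintro _ ⟨w, ⟨hw₁, hw₂⟩, rfl⟩
    rw [hcl] at hw₁
    obtain ⟨z, hz, rfl⟩ := hw₁
    rw [hginv z hz]
    exact ⟨hz, hw₂⟩)
  rwa [hginv x₀ hx₀, hginv y₀ hy₀] at hJ'

/-- **The backward direction `R ⟶ h • R`.** For `h` continuous on `closure Ω`, a path inside
`closure Ω ∩ h ⁻¹' A` joining `x₀` to `y₀` pushes forward to a path inside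
`closure (h '' Ω) ∩ A` joining `h x₀` to `h y₀`. -/
theorem icp_joinedIn_image_of_preimage (R : ConformalRectangle) {h : ℂ → ℂ}
    (hc : ContinuousOn h (closure R.carrier)) (A : Set ℂ) {x₀ y₀ : ℂ}
    (hJ : JoinedIn (closure R.carrier ∩ h ⁻¹' A) x₀ y₀) :
    JoinedIn (closure (h '' R.carrier) ∩ A) (h x₀) (h y₀) := by
  have hcl : closure (h '' R.carrier) = h '' closure R.carrier :=
    closure_image_of_isBounded R.isBounded hc
  refine icp_joinedIn_map_of_subset hJ hc inter_subset_left ?_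
  rintro _ ⟨z, ⟨hz₁, hz₂⟩, rfl⟩
  rw [hcl]
  exact ⟨mem_image_of_mem h hz₁, hz₂⟩

/-- **Continuum crossings of the image rectangle pull back under an embedding of the closure**
(S3a/S3b brick of the line).  For `h` continuous and injective on `closure Ω` and any `A ⊆ ℂ`:
some point of `h '' R.arc 0` is joined to some point of `h '' R.arc 2` inside
`closure (h '' Ω) ∩ A` iff some point of `R.arc 0` is joined to some point of `R.arc 2` inside
`closure Ω ∩ h ⁻¹' A`. -/
theorem image_crossing_iff_preimage : ∀ (R : ConformalRectangle) (h : ℂ → ℂ), ContinuousOn h (closure R.carrier) → Set.InjOn h (closure R.carrier) → ∀ (A : Set ℂ), ((∃ x ∈ h '' R.arc 0, ∃ y ∈ h '' R.arc 2, JoinedIn (closure (h '' R.carrier) ∩ A) x y) ↔ (∃ x ∈ R.arc 0, ∃ y ∈ R.arc 2, JoinedIn (closure R.carrier ∩ h ⁻¹' A) x y)) := by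
  intro R h hc hi A
  constructor
  · rintro ⟨_, ⟨x₀, hx₀, rfl⟩, _, ⟨y₀, hy₀, rfl⟩, hJ⟩
    exact ⟨x₀, hx₀, y₀, hy₀, icp_joinedIn_preimage_of_image R hc hi A
      (icp_arc_subset_closure R 0 hx₀) (icp_arc_subset_closure R 2 hy₀) hJ⟩
  · rintro ⟨x₀, hx₀, y₀, hy₀, hJ⟩
    exact ⟨h x₀, mem_image_of_mem h hx₀, h y₀, mem_image_of_mem h hy₀,
      icp_joinedIn_image_of_preimage R hc A hJ⟩

end Summit.CriticalPhenomena.CardyFormulaZ2.Cruxes.VoronoiHubFromSmirnov.MoebiusExactDelaunayDilationWard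

end
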